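import Mathlib.Geometry.Manifold.MFDeriv.Basic
import Mathlib.Geometry.Manifold.IsManifold.Basic
import Literature.NumberTheory.Transcendental.Analytification
import HarnessLib

/-!
# Analytification of a smooth `k`-scheme: reduction to holomorphic algebraic charts

This file isolates the local content of the existence of the analytification
(`Literature.NumberTheory.Transcendental.exists_isAnalytification`, Serre GAGA §2) as a named fact and proves the global assembly.

* `Literature.exists_algebraicChart X d` (named fact): every complex point of a `k`-scheme `X`
  (`k ⊆ ℂ`), smooth of relative dimension `d` and locally of finite type, has an open
  neighbourhood in `X(ℂ)` (strong topology) carrying a chart `e` onto an open subset of `ℂᵈ` whose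
  coordinates are regular functions `x₁, …, x_d ∈ Γ(X, U)` on an affine open `U`, and in which
  every regular function on every affine open is holomorphic (`C^ω`). This is Serre's
  Prop. 2 of GAGA §2 n°5 (algebraic charts are analytic charts, regular functions are holomorphic:
  Lemme 1) combined with n°6 Prop. 3, Cor. 2 and §1 n°4 (at a simple point `X^h` is a complex
  manifold, with local coordinates a regular system of parameters of `𝒪_x`); in scheme language
  SGA1 XII Thm. 1.1 (`X^an` with `|X^an| = X(ℂ)`) and Prop. 3.1 (iv) (`f` smooth `⇔ f^an` smooth,
  here `f : X_ℂ → Spec ℂ`), proved there via `𝒪̂_x ≅ 𝒪̂^an_x`; the intended Lean proof uses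
  étale coordinates of a standard smooth presentation and the holomorphic implicit function
  theorem.
* `Literature.NumberTheory.Transcendental.exists_isAnalytification_of_exists_algebraicChart` (proved): the charts of
  `exists_algebraicChart` form a holomorphic atlas on `M := X(ℂ)` (transition maps are regular
  functions read in a chart, hence holomorphic), and `id : M → X(ℂ)` is then an analytification
  in the sense of `Literature.NumberTheory.Transcendental.IsAnalytification`; Hausdorffness is the accepted fact
  `Literature.t2Space_algPoints X ℂ` (X separated). Hence
  `t2Space_algPoints X ℂ → exists_algebraicChart X d → exists_isAnalytification X d`.

## References

* J.-P. Serre, *Géométrie algébrique et géométrie analytique*, Ann. Inst. Fourier **6** (1956),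
  §1 n°4, §2 n°5 (Lemme 1, Prop. 2, Remarque), n°6 (Prop. 3, Cor. 2).
* A. Grothendieck, M. Raynaud, *SGA 1*, Exposé XII, Thm. 1.1, Prop. 2.1 (iv), Prop. 3.1 (iv).
-/

noncomputable section

open CategoryTheory AlgebraicGeometry Topology
open scoped Manifold ContDiff

namespace Literature.NumberTheory.Transcendental

variable {k : Type} [Field k] [Algebra k ℂ] (X : Literature.AlgebraicGeometry.Motives.SchemeOver k) (d : ℕ)

/-- **Holomorphic algebraic charts** (Serre, GAGA §2 n°5 Prop. 2 with n°6 Prop. 3, Cor. 2 and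
§1 n°4; SGA1 XII §1). Let `X` be a `k`-scheme (`k ⊆ ℂ`), locally of finite type and smooth of
relative dimension `d`. Every complex point `P₀ ∈ X(ℂ)` lies in the source of an open partial
homeomorphism `e` from `X(ℂ)` (strong topology) to `ℂᵈ` such that
(i) the coordinates of `e` are regular functions: there are an affine open `U ⊆ X` with
`e.source ⊆ U(ℂ)` and `x₁, …, x_d ∈ Γ(X, U)` with `e(P) = (x₁(P), …, x_d(P))` on `e.source`;
(ii) every regular function `s ∈ Γ(X, U')` on every affine open `U'` is holomorphic in the chart:
`s ∘ e⁻¹` is `C^ω` (complex analytic) on the open set `e.target ∩ e⁻¹⁻¹(U'(ℂ))`.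
(Serre: the algebraic charts are analytic charts of `X^h`, regular functions are holomorphic, and
at a simple point `X^h` is a manifold with local coordinates among the regular functions; the
scheme-theoretic proof takes for `x₁, …, x_d` étale coordinates of a standard smooth presentation
and applies the holomorphic implicit function theorem.)
[cite: SerreGAGA1956, §2 n°5 Prop. 2 and n°6 Prop. 3 Cor. 2]
[cite: SGA1, Exp. XII Thm. 1.1 and Prop. 3.1 (iv)] -/
def exists_algebraicChart : Prop :=
  ∀ [LocallyOfFiniteType X.hom] [SmoothOfRelativeDimension d X.hom] (P₀ : Literature.AlgebraicGeometry.Motives.ComplexPoints X),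
    ∃ e : OpenPartialHomeomorph (Literature.AlgebraicGeometry.Motives.ComplexPoints X) (Fin d → ℂ),
      P₀ ∈ e.source ∧
      (∃ (U : X.left.affineOpens) (x : Fin d → Γ(X.left, ↑U)),
        e.source ⊆ {P | P.pt ∈ (↑U : X.left.Opens)} ∧
        ∀ P ∈ e.source, ∀ i, e P i = Literature.AlgebraicGeometry.Motives.AlgPoints.evalOrZero ↑U (x i) P) ∧
      ∀ (U : X.left.affineOpens) (s : Γ(X.left, ↑U)),
        ContDiffOn ℂ ω (Literature.AlgebraicGeometry.Motives.AlgPoints.evalOrZero ↑U s ∘ e.symm)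
          (e.target ∩ e.symm ⁻¹' {P | P.pt ∈ (↑U : X.left.Opens)})

variable {X d}

/-- The charted-space structure on `X(ℂ)` given by a choice of holomorphic algebraic chart at
every point (the atlas of `X^h`). [Serre, GAGA §2 n°5 Prop. 2] [folklore] -/
@[reducible]
def chartedSpaceOfCharts (chart : Literature.AlgebraicGeometry.Motives.ComplexPoints X → OpenPartialHomeomorph (Literature.AlgebraicGeometry.Motives.ComplexPoints X) (Fin d → ℂ))
    (mem : ∀ P, P ∈ (chart P).source) : ChartedSpace (Fin d → ℂ) (Literature.AlgebraicGeometry.Motives.ComplexPoints X) where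
  atlas := Set.range chart
  chartAt := chart
  mem_chart_source := mem
  chart_mem_atlas P := ⟨P, rfl⟩

/-- If every chart of a family has regular coordinates and all regular functions are `C^ω` in
every chart, the family is a holomorphic atlas: transition maps are `C^ω` (each coordinate of the
second chart is a regular function, read in the first chart). [Serre, GAGA §2 n°5, Lemme 1 d) and
Prop. 2] [folklore] -/
theorem isManifold_chartedSpaceOfCharts
    (chart : Literature.AlgebraicGeometry.Motives.ComplexPoints X → OpenPartialHomeomorph (Literature.AlgebraicGeometry.Motives.ComplexPoints X) (Fin d → ℂ))
    (mem : ∀ P, P ∈ (chart P).source)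
    (alg : ∀ P, ∃ (U : X.left.affineOpens) (x : Fin d → Γ(X.left, ↑U)),
      (chart P).source ⊆ {Q | Q.pt ∈ (↑U : X.left.Opens)} ∧
      ∀ Q ∈ (chart P).source, ∀ i, chart P Q i = Literature.AlgebraicGeometry.Motives.AlgPoints.evalOrZero ↑U (x i) Q)
    (hol : ∀ P (U : X.left.affineOpens) (s : Γ(X.left, ↑U)),
      ContDiffOn ℂ ω (Literature.AlgebraicGeometry.Motives.AlgPoints.evalOrZero ↑U s ∘ (chart P).symm)
        ((chart P).target ∩ (chart P).symm ⁻¹' {Q | Q.pt ∈ (↑U : X.left.Opens)})) :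
    @IsManifold ℂ _ _ _ _ _ _ 𝓘(ℂ, Fin d → ℂ) ω (Literature.AlgebraicGeometry.Motives.ComplexPoints X) _
      (chartedSpaceOfCharts chart mem) := by
  letI := chartedSpaceOfCharts chart mem
  refine isManifold_of_contDiffOn _ _ _ ?_
  rintro e e' ⟨P, rfl⟩ ⟨P', rfl⟩
  obtain ⟨U', x', hsrc', hx'⟩ := alg P'
  simp only [modelWithCornersSelf_coe, modelWithCornersSelf_coe_symm, Set.range_id,
    Set.inter_univ, Set.preimage_id_eq, id_eq, Function.comp_id, Function.id_comp,
    OpenPartialHomeomorph.trans_source, OpenPartialHomeomorph.symm_source,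
    OpenPartialHomeomorph.coe_trans]
  refine contDiffOn_pi' fun i ↦ ?_
  refine ((hol P U' (x' i)).mono ?_).congr ?_
  · rintro w ⟨hw, hw'⟩
    exact ⟨hw, hsrc' hw'⟩
  · rintro w ⟨-, hw'⟩
    exact hx' _ hw' i

/-- **Assembly of the analytification from holomorphic algebraic charts.** If `X(ℂ)` is
Hausdorff for separated `X` (the accepted fact `Literature.t2Space_algPoints X ℂ`) and `X` has
holomorphic algebraic charts at every complex point (`Literature.exists_algebraicChart X d`), then `X`
has an analytification in the sense of `Literature.NumberTheory.Transcendental.exists_isAnalytification`: `M := X(ℂ)` with the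
atlas of these charts is a Hausdorff complex manifold modelled on `ℂᵈ`, and `id : M → X(ℂ)`
satisfies `IsAnalytification` (regular functions are holomorphic by (ii)).
[Serre, GAGA §2 n°5 Prop. 2; SGA1 XII Thm. 1.1] [cite: SerreGAGA1956, §2 n°5 Prop. 2] -/
theorem exists_isAnalytification_of_exists_algebraicChart
    (hT : Literature.AlgebraicGeometry.Motives.t2Space_algPoints X ℂ) (hC : exists_algebraicChart X d) :
    exists_isAnalytification X d := by
  intro _ _ _
  choose chart mem alg hol using fun P₀ ↦ hC P₀
  letI cs : ChartedSpace (Fin d → ℂ) (Literature.AlgebraicGeometry.Motives.ComplexPoints X) := chartedSpaceOfCharts chart mem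
  haveI hM : IsManifold 𝓘(ℂ, Fin d → ℂ) ω (Literature.AlgebraicGeometry.Motives.ComplexPoints X) :=
    isManifold_chartedSpaceOfCharts chart mem alg hol
  haveI : T2Space (Literature.AlgebraicGeometry.Motives.ComplexPoints X) := hT
  refine ⟨Literature.AlgebraicGeometry.Motives.ComplexPoints X, inferInstance, inferInstance, cs, hM, id, ?_⟩
  refine { isHomeomorph := IsHomeomorph.id, finrank_eq := by simp, mdifferentiableOn_evalOrZero := ?_ }
  intro U s m hm
  simp only [Set.preimage_id_eq, id_eq, Set.mem_setOf_eq] at hm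
  refine MDifferentiableAt.mdifferentiableWithinAt ?_
  rw [mdifferentiableAt_iff]
  refine ⟨(Literature.AlgebraicGeometry.Motives.AlgPoints.continuousOn_evalOrZero _ s).continuousAt
    ((Literature.AlgebraicGeometry.Motives.AlgPoints.isOpen_setOf_pt_mem _).mem_nhds hm), ?_⟩
  simp only [writtenInExtChartAt, extChartAt, OpenPartialHomeomorph.extend,
    modelWithCornersSelf_partialEquiv, PartialEquiv.trans_refl, modelWithCornersSelf_coe,
    Set.range_id, OpenPartialHomeomorph.toFun_eq_coe,
    OpenPartialHomeomorph.coe_toPartialEquiv_symm]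
  refine DifferentiableAt.differentiableWithinAt ?_
  have hopen : IsOpen ((chart m).target ∩ (chart m).symm ⁻¹' {Q | Q.pt ∈ (↑U : X.left.Opens)}) :=
    (chart m).isOpen_inter_preimage_symm (Literature.AlgebraicGeometry.Motives.AlgPoints.isOpen_setOf_pt_mem _)
  have hmem : chart m m ∈ (chart m).target ∩ (chart m).symm ⁻¹' {Q | Q.pt ∈ (↑U : X.left.Opens)} :=
    ⟨(chart m).map_source (mem m), by
      simp only [Set.mem_preimage, Set.mem_setOf_eq, (chart m).left_inv (mem m)]; exact hm⟩
  exact ((hol m U s).differentiableOn (by simp)).differentiableAt (hopen.mem_nhds hmem)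

end Literature.NumberTheory.Transcendental
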